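import Summits.QuantumFields.BalabanUV.T4Continuum.Support.NE7K1LinFoldMatrices
import Summits.QuantumFields.BalabanUV.T4Continuum.Support.NE7K1LinSchurFold
import Summits.QuantumFields.BalabanUV.T4Continuum.Support.NE7K1LinWalkLine
import Summits.QuantumFields.BalabanUV.T4Continuum.Support.NE7K1LinSchurBilinError

/-!
# NE7K1LinTorusChart — row NE7 (node U5), candidate route HOM, path H1L, cell K1-lin(s): RUN B ON THE DOUBLED TORUS IN THE
# BLOCK CHART — the chart is surjective, the periodic fine operator dominates the Neumann one, both fluctuation blocks are
# invertible (NEEDS-ESTIMATE #E1, input I2 — the Schur data of «LEMMA F»)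

Lineage `b2b-balaban-t4-ne7-p2` (CRUX PROVER NE7 #2), generation 72; file 33.  The algebraic «LEMMA F» of file 30
(`NE7K1LinSchurFold.schurC_intertwine`) needs, besides the three intertwinings of file 32, the SCHUR DATA of both sides: the
read-out identity (file 32's `bsum_coordT`), a SURJECTIVE chart, and an INVERTIBLE fluctuation block.  THIS FILE:

* §1 **`coordT_surj`** — the tree's block chart `T(V,ψ)` (`NE7K1LinBlockCoords.coordT`) is onto: every fine field is `T(V,ψ)` with
  `V` = its block means and `ψ` = its in-block deviations from the mean at the non-anchor offsets (`card_NZ_add_one`).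
* §2 THE PERIODIC FINE OPERATOR DOMINATES THE NEUMANN ONE: `torOpK n a N 𝕋 − fineOpR n a 0 𝕋 = lap (wrapC)` with the
  wrap-around coupling `wrapC = n²·tadj − adjC ≥ 0` symmetric (`torOpK_sub_fineOpR`), hence **`form_torOpK_ge`**:
  `⟨φ, fineOpR φ⟩ ≤ ⟨φ, torOpK φ⟩` (`Beta.CombesThomasForm.lap_form`).
* §3 RUN B ON THE TORUS IN THE CHART: `torB = chartOp (L^{d+1})⁻¹ T (torOpK (nL) a N 𝕋)` (the tree's `runB` is the same display
  with `fineOpR (nL) a 0`: `runB_eq_chartOp`); `form_chartOp`; **`isUnit_det_runB_fluct`** and **`isUnit_det_torB_fluct`** — both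
  fluctuation blocks are coercive with the floor `2n²∕L^{d+1}` of `NE7K1LinWalkLine.runB_form_ge_fluct` (the torus one by
  domination), hence invertible; so both hard Schur complements exist at EVERY `a ≥ 0`, in particular at `a = 0`.

HONEST FRAMING: [folklore]; finite-dimensional bookkeeping + one quadratic-form comparison; no new estimate; nothing of
Bałaban's asserted; no `sorry`.  Census only (I2's Schur data); NE7 NOT PRINTED ∕ NOT PROVED; spine 0∕9; FIXED FINITE T⁴, rung
(B)+1; NOT infinite volume, NOT mass gap, NOT Clay.  HONEST DEPENDENCY: continuum YM on T⁴ ⇐ BetaPertH ∧ nine spine estimates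
(0/9 proved); BetaPertH ⇐ (D1) ∧ (D4) ∧ CAP+tail; G-an2-4 gates asym, D1 and NE2/3/4.
-/

noncomputable section

open Finset Matrix

namespace Summit.QuantumFields.BalabanUV.T4Continuum.NE7K1LinTorusChart

open Literature.MathematicalPhysics.QuantumFieldTheory.Balaban1983to89
open Literature.MathematicalPhysics.QuantumFieldTheory.Balaban1983to89.B4Reflection242
open Literature.MathematicalPhysics.QuantumFieldTheory.Balaban1983to89.B4Lower18
open Literature.MathematicalPhysics.QuantumFieldTheory.Balaban1983to89.Beta.CombesThomasForm (lap lap_apply lap_form)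
open NE7K1LinFoldKernels NE7K1LinFoldMatrices NE7K1LinSchurFold NE7K1LinBlockCoords NE7K1LinSchurLineU1
  NE7K1LinSchurLineForm NE7K1LinWalkLine NE7K1LinSchurBilinError NE7K1LinTwoRunKit

variable {d : ℕ}

/-! ### §1 The block chart is surjective -/

section Chart

variable {L : ℕ} [NeZero L] {R' : Finset (Fin (d + 1) → ℤ)}

/-- `#(non-zero offsets) + 1 = L^{d+1}`. [folklore] -/
theorem card_NZ_add_one : (Fintype.card (NZ d L) : ℝ) + 1 = (L : ℝ) ^ (d + 1) := by
  classical
  have h := sum_offsets_split (d := d) (L := L) (fun _ => (1 : ℝ))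
  simp only [Finset.sum_const, Finset.card_univ, nsmul_eq_mul, mul_one, Fintype.card_pi, Finset.prod_const,
    Fintype.card_fin] at h
  push_cast at h
  linarith

/-- **THE BLOCK CHART IS ONTO**: every fine field is `T(V,ψ)` with `V_b = L^{−(d+1)}Σ_{block b}φ` (block means) and
`ψ_{b,j} = φ(rchart b j) − V_b` (`j ≠ 0`). [folklore] -/
theorem coordT_surj (hR'L : IsBlockUnion L R') (φ : ↥R' → ℝ) :
    ∃ u : ↥(R'.image (blk L)) ⊕ (↥(R'.image (blk L)) × NZ d L) → ℝ, coordT hR'L *ᵥ u = φ := by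
  classical
  set m : ↥(R'.image (blk L)) → ℝ := fun b =>
    ((L : ℝ) ^ (d + 1))⁻¹ * ∑ j : Fin (d + 1) → Fin L, φ (rchart NeZero.one_le hR'L b j) with hm
  refine ⟨Sum.elim m (fun bj => φ (rchart NeZero.one_le hR'L bj.1 bj.2.1) - m bj.1), ?_⟩
  have hLpow : ((L : ℝ) ^ (d + 1)) ≠ 0 := pow_ne_zero _ (by exact_mod_cast (NeZero.ne L))
  ext x
  obtain ⟨j, hj⟩ := rchart_surj NeZero.one_le hR'L x
  rw [← hj, coordT_mulVec_rchart]
  simp only [Sum.elim_inl, Sum.elim_inr]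
  by_cases hj0 : j = 0
  · subst hj0
    rw [dif_neg (by simp), Finset.sum_sub_distrib, Finset.sum_const, Finset.card_univ, nsmul_eq_mul]
    have hsplit := sum_offsets_split (d := d) (L := L) (fun j => φ (rchart NeZero.one_le hR'L (rblk L R' x) j))
    have hcard := card_NZ_add_one (d := d) (L := L)
    have hmb : m (rblk L R' x) * (L : ℝ) ^ (d + 1) = ∑ j : Fin (d + 1) → Fin L, φ (rchart NeZero.one_le hR'L (rblk L R' x) j) := by
      rw [hm]; field_simp
    -- `m + (card·m − Σ_{NZ}) = m·L^{d+1} − Σ_{NZ} = φ(anchor)`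
    have : m (rblk L R' x) + -(∑ j' : NZ d L, φ (rchart NeZero.one_le hR'L (rblk L R' x) j'.1) -
        (Fintype.card (NZ d L) : ℝ) * m (rblk L R' x)) = m (rblk L R' x) * ((Fintype.card (NZ d L) : ℝ) + 1) -
        ∑ j' : NZ d L, φ (rchart NeZero.one_le hR'L (rblk L R' x) j'.1) := by ring
    rw [this, hcard, hmb, hsplit]
    ring
  · rw [dif_pos hj0]
    ring

end Chart

/-! ### §2 The periodic fine operator dominates the Neumann one on the representatives -/

section Domination

variable {n : ℕ} {a : ℝ} {N : Fin (d + 1) → ℕ} {F : Finset (Fin (d + 1) → ℤ)}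

/-- the WRAP-AROUND COUPLING `n²·tadj_N(x,y) − n²·[y ~ x]` (the torus bonds that are not box bonds, with multiplicity).
[folklore] -/
def wrapC (n : ℕ) (N : Fin (d + 1) → ℕ) (F : Finset (Fin (d + 1) → ℤ)) (x y : ↥F) : ℝ :=
  (n : ℝ) ^ 2 * (tadj N x.1 y.1 : ℝ) - adjC n F x y

/-- the wrap-around coupling is symmetric on representatives. [folklore] -/
theorem wrapC_symm (hF : F = boxDom (dbl N)) (x y : ↥F) : wrapC n N F x y = wrapC n N F y x := by
  subst hF
  rw [wrapC, wrapC, tadj_comm x.2 y.2, adjC_symm]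

/-- the wrap-around coupling is non-negative (the periodised adjacency dominates the box adjacency). [folklore] -/
theorem wrapC_nonneg (hF : F = boxDom (dbl N)) (x y : ↥F) : 0 ≤ wrapC n N F x y := by
  subst hF
  unfold wrapC adjC
  split_ifs with h
  · have h1 : (1 : ℝ) ≤ (tadj N x.1 y.1 : ℝ) := by exact_mod_cast one_le_tadj_of_mem_nbrs y.2 h
    nlinarith [sq_nonneg (n : ℝ)]
  · have h1 : (0 : ℝ) ≤ (tadj N x.1 y.1 : ℝ) := by positivity
    rw [sub_zero]; positivity

/-- the total periodised degree on representatives, real form. [folklore] -/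
theorem sum_tadj_real (hN : ∀ i, 1 ≤ N i) (x : ↥(boxDom (dbl N))) :
    ∑ l : ↥(boxDom (dbl N)), (tadj N x.1 l.1 : ℝ) = 2 * ((d : ℝ) + 1) := by
  rw [Finset.sum_coe_sort (boxDom (dbl N)) (fun l => (tadj N x.1 l : ℝ))]
  exact_mod_cast sum_tadj hN x.1

/-- **`torOpK − fineOpR = lap (wrapC)`**: the periodic and the Neumann fine operators on the representatives differ by the
weighted graph Laplacian of the wrap-around bonds. [folklore] -/
theorem torOpK_sub_fineOpR (n : ℕ) (a : ℝ) (hN : ∀ i, 1 ≤ N i) (hF : F = boxDom (dbl N)) :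
    torOpK n a N F - fineOpR n a 0 F = lap (wrapC n N F) := by
  classical
  subst hF
  ext x y
  rw [Matrix.sub_apply, torOpK_apply, fineOpR_zero_apply, lap_apply]
  have hs : ∑ l : ↥(boxDom (dbl N)), wrapC n N (boxDom (dbl N)) x l =
      (n : ℝ) ^ 2 * (2 * ((d : ℝ) + 1)) - (n : ℝ) ^ 2 * ((((nbrs x.1).filter fun z => z ∈ boxDom (dbl N)).card : ℕ) : ℝ) := by
    simp only [wrapC, Finset.sum_sub_distrib, ← Finset.mul_sum, sum_tadj_real hN x, sum_adjC_eq]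
  rw [hs]
  by_cases hxy : x = y
  · subst hxy
    have hnn : x.1 ∉ nbrs x.1 := not_mem_nbrs_self x.1
    simp only [if_true, neumannLapR, wrapC, adjC, hnn, if_false]
    ring
  · have h1 : y.1 ≠ x.1 := fun h => hxy (Subtype.ext h.symm)
    simp only [if_neg hxy, neumannLapR, if_neg h1, wrapC, adjC]
    split_ifs <;> ring

/-- **DOMINATION**: `⟨φ, fineOpR n a 0 𝕋 φ⟩ ≤ ⟨φ, torOpK n a N 𝕋 φ⟩` for every `φ` and every `a`. [folklore] -/
theorem form_torOpK_ge (n : ℕ) (a : ℝ) (hN : ∀ i, 1 ≤ N i) (hF : F = boxDom (dbl N)) (φ : ↥F → ℝ) :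
    φ ⬝ᵥ fineOpR n a 0 F *ᵥ φ ≤ φ ⬝ᵥ torOpK n a N F *ᵥ φ := by
  have h : torOpK n a N F = fineOpR n a 0 F + lap (wrapC n N F) := by
    rw [← torOpK_sub_fineOpR n a hN hF, add_sub_cancel]
  have hform := lap_form (wrapC n N F) (wrapC_symm hF) φ
  have hnn : 0 ≤ ∑ j, ∑ k, wrapC n N F j k * (φ j - φ k) ^ 2 :=
    Finset.sum_nonneg fun j _ => Finset.sum_nonneg fun k _ => mul_nonneg (wrapC_nonneg hF j k) (sq_nonneg _)
  rw [h, Matrix.add_mulVec, dotProduct_add, hform]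
  linarith

end Domination

/-! ### §3 Run B on the torus in the chart; both fluctuation blocks are invertible -/

section TorusChart

variable {n L : ℕ} [NeZero L] {R' T : Finset (Fin (d + 1) → ℤ)} {N : Fin (d + 1) → ℕ}

/-- **RUN B ON THE DOUBLED TORUS IN THE BLOCK CHART**: `H_B^𝕋 = (L^{d+1})⁻¹·Tᵀ·torOpK (nL) a N 𝕋·T`. [folklore] -/
def torB (hTL : IsBlockUnion L T) (n : ℕ) (a : ℝ) (N : Fin (d + 1) → ℕ) : Matrix (Idx L T) (Idx L T) ℝ :=
  chartOp (((L : ℝ) ^ (d + 1))⁻¹) (coordT hTL) (torOpK (n * L) a N T)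

/-- the tree's `runB` is the chart operator of the Neumann `fineOpR (nL) a 0`. [folklore] -/
theorem runB_eq_chartOp (hR'L : IsBlockUnion L R') (n : ℕ) (a : ℝ) :
    runB hR'L n a = chartOp (((L : ℝ) ^ (d + 1))⁻¹) (coordT hR'L) (fineOpR (n * L) a 0 R') := rfl

omit [NeZero L] in
/-- the quadratic form of a chart operator: `⟨u, (c·TᵀMT)u⟩ = c·⟨Tu, M(Tu)⟩`. [folklore] -/
theorem form_chartOp {ι κc κf : Type*} [Fintype ι] [Fintype κc] [Fintype κf] (c : ℝ) (T₀ : Matrix ι (κc ⊕ κf) ℝ)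
    (M : Matrix ι ι ℝ) (u : κc ⊕ κf → ℝ) : u ⬝ᵥ chartOp c T₀ M *ᵥ u = c * ((T₀ *ᵥ u) ⬝ᵥ M *ᵥ (T₀ *ᵥ u)) := by
  rw [chartOp_mulVec, dotProduct_smul, smul_eq_mul, Matrix.dotProduct_mulVec u, Matrix.vecMul_transpose]

/-- **DOMINATION IN THE CHART**: `⟨u, H_B u⟩ ≤ ⟨u, H_B^𝕋 u⟩` on the representatives `𝕋 = boxDom (dbl N)`. [folklore] -/
theorem torB_form_ge (hT' : IsBlockUnion (n * L) T) (hT : T = boxDom (dbl N)) (hN : ∀ i, 1 ≤ N i) (a : ℝ)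
    (u : Idx L T → ℝ) :
    u ⬝ᵥ runB (isBlockUnion_fine hT') n a *ᵥ u ≤ u ⬝ᵥ torB (isBlockUnion_fine hT') n a N *ᵥ u := by
  rw [runB_eq_chartOp, torB, form_chartOp, form_chartOp]
  exact mul_le_mul_of_nonneg_left (form_torOpK_ge (n * L) a hN hT _) (by positivity)

/-- **THE NEUMANN FLUCTUATION BLOCK IS INVERTIBLE at every `a ≥ 0`** (floor `2n²∕L^{d+1}`, `runB_form_ge_fluct`). [folklore] -/
theorem isUnit_det_runB_fluct (hn : 1 ≤ n) (hR' : IsBlockUnion (n * L) R') {a : ℝ} (ha : 0 ≤ a) :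
    IsUnit ((runB (isBlockUnion_fine hR') n a).toBlocks₂₂).det := by
  have hn0 : (0 : ℝ) < n := by exact_mod_cast hn
  have hL0 : (0 : ℝ) < L := by exact_mod_cast (NeZero.one_le : 1 ≤ L)
  refine isUnit_det_of_coercive _ (σ := 2 * (n : ℝ) ^ 2 / (L : ℝ) ^ (d + 1))
    (div_pos (mul_pos two_pos (pow_pos hn0 2)) (pow_pos hL0 _)) fun ψ => ?_
  rw [← form_inr]
  exact runB_form_ge_fluct hn hR' ha 0 ψ

/-- **THE PERIODIC FLUCTUATION BLOCK IS INVERTIBLE at every `a ≥ 0`** (domination + the Neumann floor). [folklore] -/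
theorem isUnit_det_torB_fluct (hn : 1 ≤ n) (hT' : IsBlockUnion (n * L) T) (hT : T = boxDom (dbl N)) (hN : ∀ i, 1 ≤ N i)
    {a : ℝ} (ha : 0 ≤ a) : IsUnit ((torB (isBlockUnion_fine hT') n a N).toBlocks₂₂).det := by
  have hn0 : (0 : ℝ) < n := by exact_mod_cast hn
  have hL0 : (0 : ℝ) < L := by exact_mod_cast (NeZero.one_le : 1 ≤ L)
  refine isUnit_det_of_coercive _ (σ := 2 * (n : ℝ) ^ 2 / (L : ℝ) ^ (d + 1))
    (div_pos (mul_pos two_pos (pow_pos hn0 2)) (pow_pos hL0 _)) fun ψ => ?_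
  rw [← form_inr]
  exact (runB_form_ge_fluct hn hT' ha 0 ψ).trans (torB_form_ge hT' hT hN a _)

end TorusChart

end Summit.QuantumFields.BalabanUV.T4Continuum.NE7K1LinTorusChart

end
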